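import Literature.NumberTheory.EllipticCurves.HeegnerGeomCoherentDataProofs
import HarnessLib

/-!
# Descent of the shifted Heegner data by ONE anticyclotomic layer: the layers above a layer, the
# transversal shared by `u_k`, `v_k` read in the layer below, and the ITERATED vertical recurrence
# (CGLS 2022 Thm. 4.1.1 proof / Rem. 4.1.4; Howard 2004 §3.3; Perrin-Riou 1987 §3.3) — THEOREMS ONLY

Topic `NumberTheory/EllipticCurves` (complex multiplication / Heegner points); namespace
`Literature.NumberTheory.EllipticCurves`. No definition, no named fact, no `sorry`. Cell `pub/bsd-print-x9`,
seat `bsd-line-x9-p1-w2` (stub worker; envelope of the crux stmt-BirchSwinnertonDyer-26359, REVERSE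
direction: the stabilised classes `κ_k = α^{-d(k)}(u_k − α⁻¹ v_k)` in terms of Howard's generators `z_j`).
Sequel of the lead's `HeegnerGeomTransversalProofs` / `HeegnerGeomTowerRecurrenceProofs` /
`HeegnerGeomRelayerProofs` / `HeegnerGeomCoherentDataProofs`.

* §0 `ZpExtension.layerSubgroup_le_of_not_le_layerSubgroup_succ` — a subgroup of `Γ_K` containing
  `Gal(K̄/K_{k+1})` and not contained in it contains `Gal(K̄/K_k)` (the subgroups above a layer are layers:
  `Gal(K_{k+1}/K) ≅ ℤ/p^{k+1}` through `κ`; a `p`-adic valuation argument).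
* §1 `layerSubgroup_succ_sup_ringClassSubgroup_eq` — for `d ≥ 2` with `Gal(K̄/K[p^d]) ≤ Gal(K̄/K_{k+1})` and
  `Gal(K̄/K[p^{d-1}]) ≰ Gal(K̄/K_{k+1})`: `Gal(K̄/K_{k+1}) ⊔ Gal(K̄/K[p^{d-1}]) = Gal(K̄/K_k)` (index count:
  `[K[p^d] : K[p^{d-1}]] = p = [K_{k+1} : K_k]`), whence `Gal(K̄/K[p^{d-1}]) ≤ Gal(K̄/K_k)` — the shift drops by
  at least one per layer, `d(k) ≤ d(k+1) − 1` (`ringClassSubgroup_pred_le_layerSubgroup`) — and the transversal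
  `A_{k+1}` of `Gal(K̄/K[p^d])` in `Gal(K̄/K_{k+1})` (through which `u_{k+1}`, `v_{k+1}` are sums) is ALSO a
  transversal of `Gal(K̄/K[p^{d-1}])` in `Gal(K̄/K_k)` (`transversal_ringClassSubgroup_pred_layerSubgroup`):
  `v_{k+1} = Norm_{K[p^{d-1}]/K_k} P[p^{d-1}]` is a norm point OF THE LAYER BELOW.
* §2 `sum_transversal_smul_eq_lucas_smul_add` — the ITERATED recurrence in a fixed `Λ ≥ Gal(K̄/K[p^d])`,
  `d ≥ 1`: for every `n` and every transversal `R` of `Gal(K̄/K[p^{d+n}])` in `Λ`,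
  `∑_R r • x_{d+n} = A_n • u + B_n • v`, `u = ∑_T t • x_d`, `v = ∑_T t • x_{d-1}` over one transversal `T` of
  `Gal(K̄/K[p^d])` in `Λ`, for ANY integer sequences with `A₀ = 1, A₁ = a_p`, `B₀ = 0, B₁ = −1`,
  `X_{n+2} = a_p X_{n+1} − p X_n` (two-step induction over the one-step descent and the two-term recurrence);
  `not_dvd_lucas_of_not_dvd`: `p ∤ A_n` when `p ∤ a_p` (ordinary `p`).
HONEST FRAMING: Galois bookkeeping plus the cited CM relations; nothing on `L`-functions, Selmer groups or BSD
is asserted; BSD is not proved by any of this.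

References: [CastellaGrossiLeeSkinner2022] Thm. 4.1.1 proof (`d(k)`, `P_k[n]`), Rem. 4.1.4 (arXiv:2008.02571v2
p. 22); [Howard2004HeegnerKolyvagin] §3.3; [PerrinRiou1987BSMF] §3.3 (relations de distribution);
[Washington1997] §13.1 (layers of a ℤ_p-extension).
-/

set_option autoImplicit false

noncomputable section

open scoped Classical

namespace Literature.NumberTheory.EllipticCurves

open WeierstrassCurve RingClassField

variable {K : Type} [Field K] [NumberField K]

/-! ## §0 The subgroups of `Γ_K` above a layer are layers -/

omit [NumberField K] in
/-- **A subgroup of `Γ_K` containing `Gal(K̄/K_{k+1})` and not contained in it contains `Gal(K̄/K_k)`**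
(`Gal(K_{k+1}/K) ≅ ℤ/p^{k+1}` is cyclic: its subgroups form a chain). Proof through `κ : Γ_K → ℤ_p`: pick
`h ∈ H` with `p^{k+1} ∤ κ(h)`; for `τ` with `p^k ∣ κ(τ)` some `h^{-n} τ` has `p^{k+1} ∣ κ`, so `τ ∈ H`.
[cite: Washington1997, §13.1 (Gal(K_n/K) ≅ ℤ/p^n ℤ; the intermediate fields of a ℤ_p-extension are the layers)] -/
theorem ZpExtension.layerSubgroup_le_of_not_le_layerSubgroup_succ {p : ℕ} [Fact p.Prime]
    (κ : ZpExtension K p) {k : ℕ} {H : Subgroup (Field.absoluteGaloisGroup K)}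
    (hle : κ.layerSubgroup (k + 1) ≤ H) (hnot : ¬ H ≤ κ.layerSubgroup (k + 1)) :
    κ.layerSubgroup k ≤ H := by
  obtain ⟨h, hhH, hh⟩ := Set.not_subset.mp hnot
  rw [SetLike.mem_coe, ZpExtension.mem_layerSubgroup] at hh
  intro τ hτ
  rw [ZpExtension.mem_layerSubgroup] at hτ
  set a : ℤ_[p] := (κ h).toAdd with ha_def
  set b : ℤ_[p] := (κ τ).toAdd with hb_def
  have ha0 : a ≠ 0 := by
    intro h0; exact hh (h0 ▸ dvd_zero _)
  -- `v(a) ≤ k`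
  have hval : a.valuation ≤ k := by
    by_contra hlt
    exact hh (Ideal.mem_span_singleton.mp
      ((PadicInt.mem_span_pow_iff_le_valuation a ha0 (k + 1)).mpr (by omega)))
  obtain ⟨b', hb'⟩ := hτ
  set j := a.valuation with hj
  obtain ⟨u, hau⟩ : ∃ u : ℤ_[p]ˣ, a = (u : ℤ_[p]) * (p : ℤ_[p]) ^ j := ⟨_, PadicInt.unitCoeff_spec ha0⟩
  -- `b = a * c`
  set c : ℤ_[p] := ((u⁻¹ : ℤ_[p]ˣ) : ℤ_[p]) * (p : ℤ_[p]) ^ (k - j) * b' with hc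
  have hbc : b = a * c := by
    rw [hb', hau, hc]
    calc (p : ℤ_[p]) ^ k * b'
        = (p : ℤ_[p]) ^ (j + (k - j)) * b' := by rw [Nat.add_sub_cancel' hval]
      _ = ((u : ℤ_[p]) * ((u⁻¹ : ℤ_[p]ˣ) : ℤ_[p])) * ((p : ℤ_[p]) ^ j * (p : ℤ_[p]) ^ (k - j)) * b' := by
          rw [Units.mul_inv, one_mul, pow_add]
      _ = (u : ℤ_[p]) * (p : ℤ_[p]) ^ j * (((u⁻¹ : ℤ_[p]ˣ) : ℤ_[p]) * (p : ℤ_[p]) ^ (k - j) * b') := by ring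
  -- an integer `n` with `p^{k+1-j} ∣ c - n`
  set n : ℕ := PadicInt.appr c (k + 1 - j) with hn
  obtain ⟨r, hr⟩ := Ideal.mem_span_singleton.mp (PadicInt.appr_spec (k + 1 - j) c)
  -- `h^{-n} τ ∈ Gal(K̄/K_{k+1})`
  have hmem : (h ^ n)⁻¹ * τ ∈ κ.layerSubgroup (k + 1) := by
    rw [ZpExtension.mem_layerSubgroup, map_mul, map_inv, map_pow, toAdd_mul, toAdd_inv, toAdd_pow,
      ← ha_def, ← hb_def]
    refine ⟨(u : ℤ_[p]) * r, ?_⟩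
    have hcn : c - (n : ℤ_[p]) = (p : ℤ_[p]) ^ (k + 1 - j) * r := hr
    calc -(n • a) + b = a * (c - (n : ℤ_[p])) := by rw [hbc, nsmul_eq_mul]; ring
      _ = (u : ℤ_[p]) * (p : ℤ_[p]) ^ j * ((p : ℤ_[p]) ^ (k + 1 - j) * r) := by rw [hcn, hau]
      _ = (p : ℤ_[p]) ^ (j + (k + 1 - j)) * ((u : ℤ_[p]) * r) := by rw [pow_add]; ring
      _ = (p : ℤ_[p]) ^ (k + 1) * ((u : ℤ_[p]) * r) := by
          rw [Nat.add_sub_cancel' (by omega : j ≤ k + 1)]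
  have hτeq : τ = h ^ n * ((h ^ n)⁻¹ * τ) := by group
  rw [hτeq]
  exact H.mul_mem (H.pow_mem hhH n) (hle hmem)

/-! ## §1 One layer down: `Gal(K̄/K_{k+1}) ⊔ Gal(K̄/K[p^{d-1}]) = Gal(K̄/K_k)` and the shared transversal -/

/-- **`Gal(K̄/K_{k+1}) ⊔ Gal(K̄/K[p^{d-1}]) = Gal(K̄/K_k)`** when `K_{k+1} ⊆ K[p^d]`, `K_{k+1} ⊄ K[p^{d-1}]`,
`d ≥ 2` (CGLS: `K_{k+1}·K[p^{d-1}] = K[p^d]` read one layer down: `K_{k+1} ∩ K[p^{d-1}] = K_k`). The join lies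
strictly above `Gal(K̄/K_{k+1})`, so contains `Gal(K̄/K_k)` (§0); and it has index `p` under it, as
`[Gal(K̄/K[p^{d-1}]) : Gal(K̄/K[p^d])] = p` (`relIndex_ringClassSubgroup_eq_prime`, re-layering
`inf_ringClassSubgroup_eq_of_not_le`), like `Gal(K̄/K_k)` — so they coincide.
[cite: CastellaGrossiLeeSkinner2022, Thm. 4.1.1 proof (d(k), K_k ⊂ K[p^{d(k)}]) and Rem. 4.1.4] [cite: Cox2013, §7.D Cor. 7.28] -/
theorem layerSubgroup_succ_sup_ringClassSubgroup_eq (hK : IsImaginaryQuadratic K)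
    (jbar : AlgebraicClosure K →+* ℂ) {p : ℕ} [Fact p.Prime] (κ : ZpExtension K p) {k d : ℕ} (hd : 2 ≤ d)
    (hle : ringClassSubgroup K (p ^ d) jbar ≤ κ.layerSubgroup (k + 1))
    (hnot : ¬ ringClassSubgroup K (p ^ (d - 1)) jbar ≤ κ.layerSubgroup (k + 1)) :
    κ.layerSubgroup (k + 1) ⊔ ringClassSubgroup K (p ^ (d - 1)) jbar = κ.layerSubgroup k := by
  have hp : p.Prime := Fact.out
  set L := κ.layerSubgroup (k + 1) with hL
  set Rg := ringClassSubgroup K (p ^ (d - 1)) jbar with hRg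
  -- `Gal(K̄/K_k) ≤ L ⊔ Rg` (§0)
  have hkJ : κ.layerSubgroup k ≤ L ⊔ Rg :=
    κ.layerSubgroup_le_of_not_le_layerSubgroup_succ le_sup_left fun h ↦ hnot (le_sup_right.trans h)
  -- `[L ⊔ Rg : L] = p`
  have hrel : L.relIndex (L ⊔ Rg) = p := by
    rw [Subgroup.relIndex_sup_left, ← Subgroup.inf_relIndex_right, hL, hRg,
      inf_ringClassSubgroup_eq_of_not_le hK jbar hp hd hle hnot]
    have hpd : p ^ d = p * p ^ (d - 1) := by
      rw [← pow_succ']; congr 1; omega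
    rw [hpd]
    exact relIndex_ringClassSubgroup_eq_prime hK jbar hp (dvd_pow_self p (by omega))
      (pow_ne_zero _ hp.ne_zero)
  -- hence `[Γ_K : L ⊔ Rg] = p^k = [Γ_K : Gal(K̄/K_k)]`
  have hJidx : (L ⊔ Rg).index = p ^ k := by
    have h1 := Subgroup.relIndex_mul_index (le_sup_left : L ≤ L ⊔ Rg)
    rw [hrel, hL, ZpExtension.index_layerSubgroup, pow_succ'] at h1
    exact Nat.eq_of_mul_eq_mul_left hp.pos h1
  have h2 := Subgroup.relIndex_mul_index hkJ
  rw [hJidx, ZpExtension.index_layerSubgroup] at h2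
  have hone : (κ.layerSubgroup k).relIndex (L ⊔ Rg) = 1 :=
    Nat.eq_of_mul_eq_mul_right (pow_pos hp.pos k) (h2.trans (one_mul _).symm)
  exact le_antisymm (Subgroup.relIndex_eq_one.mp hone) hkJ

/-- **The shift drops by at least one per layer**: under the hypotheses of
`layerSubgroup_succ_sup_ringClassSubgroup_eq`, `Gal(K̄/K[p^{d-1}]) ≤ Gal(K̄/K_k)`, i.e. `K_k ⊆ K[p^{d-1}]`
(`d(k) ≤ d(k+1) − 1` for the minimal shifts of CGLS). [cite: CastellaGrossiLeeSkinner2022, Thm. 4.1.1 proof (d(k))] -/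
theorem ringClassSubgroup_pred_le_layerSubgroup (hK : IsImaginaryQuadratic K)
    (jbar : AlgebraicClosure K →+* ℂ) {p : ℕ} [Fact p.Prime] (κ : ZpExtension K p) {k d : ℕ} (hd : 2 ≤ d)
    (hle : ringClassSubgroup K (p ^ d) jbar ≤ κ.layerSubgroup (k + 1))
    (hnot : ¬ ringClassSubgroup K (p ^ (d - 1)) jbar ≤ κ.layerSubgroup (k + 1)) :
    ringClassSubgroup K (p ^ (d - 1)) jbar ≤ κ.layerSubgroup k := by
  rw [← layerSubgroup_succ_sup_ringClassSubgroup_eq hK jbar κ hd hle hnot]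
  exact le_sup_right

/-- **The transversal of `u_{k+1}` serves `v_{k+1}` IN THE LAYER BELOW**: a transversal `A` of
`Gal(K̄/K[p^d])` in `Gal(K̄/K_{k+1})` (`K_{k+1} ⊆ K[p^d]`, `K_{k+1} ⊄ K[p^{d-1}]`, `d ≥ 2`) is also a transversal
of `Gal(K̄/K[p^{d-1}])` in `Gal(K̄/K_k)` — so `v_{k+1} = ∑_{a ∈ A} a • P[p^{d-1}] = Norm_{K[p^{d-1}]/K_k} P[p^{d-1}]`
is the conductor-`p^{d-1}` norm point of the layer `K_k` (CGLS: `Norm_{K_{k+1}K[p^{d-1}]/K_{k+1}}` with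
`K_{k+1} ∩ K[p^{d-1}] = K_k`). [cite: CastellaGrossiLeeSkinner2022, Thm. 4.1.1 proof (P_k[n]) and Rem. 4.1.4 (P[p^{d(k)-1}])]
[cite: Howard2004HeegnerKolyvagin, §3.3] -/
theorem transversal_ringClassSubgroup_pred_layerSubgroup (hK : IsImaginaryQuadratic K)
    (jbar : AlgebraicClosure K →+* ℂ) {p : ℕ} [Fact p.Prime] (κ : ZpExtension K p) {k d : ℕ} (hd : 2 ≤ d)
    (hle : ringClassSubgroup K (p ^ d) jbar ≤ κ.layerSubgroup (k + 1))
    (hnot : ¬ ringClassSubgroup K (p ^ (d - 1)) jbar ≤ κ.layerSubgroup (k + 1))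
    {A : Finset (Field.absoluteGaloisGroup K)} (hA : ∀ a ∈ A, a ∈ κ.layerSubgroup (k + 1))
    (htA : ∀ τ ∈ κ.layerSubgroup (k + 1), ∃! a, a ∈ A ∧ a⁻¹ * τ ∈ ringClassSubgroup K (p ^ d) jbar) :
    (∀ a ∈ A, a ∈ κ.layerSubgroup k) ∧
      ∀ τ ∈ κ.layerSubgroup k, ∃! a, a ∈ A ∧ a⁻¹ * τ ∈ ringClassSubgroup K (p ^ (d - 1)) jbar := by
  have hp : p.Prime := Fact.out
  have hanti : ringClassSubgroup K (p ^ d) jbar ≤ ringClassSubgroup K (p ^ (d - 1)) jbar :=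
    ringClassSubgroup_anti hK jbar (pow_dvd_pow p (Nat.sub_le d 1)) (pow_ne_zero _ hp.ne_zero)
  refine ⟨fun a ha ↦ κ.layerSubgroup_antitone (Nat.le_succ k) (hA a ha), fun τ hτ ↦ ?_⟩
  -- existence: `τ ∈ Gal(K̄/K_k) = Gal(K̄/K_{k+1}) · Gal(K̄/K[p^{d-1}])`
  have hτ' : τ ∈ ((κ.layerSubgroup (k + 1) ⊔ ringClassSubgroup K (p ^ (d - 1)) jbar :
      Subgroup (Field.absoluteGaloisGroup K)) : Set (Field.absoluteGaloisGroup K)) := by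
    rw [layerSubgroup_succ_sup_ringClassSubgroup_eq hK jbar κ hd hle hnot]; exact hτ
  rw [Subgroup.normal_mul] at hτ'
  obtain ⟨l, hl, ρ, hρ, rfl⟩ := Set.mem_mul.mp hτ'
  obtain ⟨a, ⟨haA, ha⟩, -⟩ := htA l hl
  have hmem : ∀ b ∈ A, b⁻¹ * l ∈ ringClassSubgroup K (p ^ d) jbar →
      b⁻¹ * (l * ρ) ∈ ringClassSubgroup K (p ^ (d - 1)) jbar := fun b _ hb ↦ by
    rw [← mul_assoc]; exact Subgroup.mul_mem _ (hanti hb) hρ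
  refine ⟨a, ⟨haA, hmem a haA ha⟩, fun b hb ↦ ?_⟩
  -- uniqueness: `b⁻¹ a ∈ Gal(K̄/K_{k+1}) ⊓ Gal(K̄/K[p^{d-1}]) = Gal(K̄/K[p^d])`
  obtain ⟨hbA, hb'⟩ := hb
  have hba : b⁻¹ * a ∈ ringClassSubgroup K (p ^ (d - 1)) jbar := by
    have h := Subgroup.mul_mem _ hb' (Subgroup.inv_mem _ (hmem a haA ha))
    rwa [show b⁻¹ * (l * ρ) * (a⁻¹ * (l * ρ))⁻¹ = b⁻¹ * a by group] at h
  have hbaL : b⁻¹ * a ∈ κ.layerSubgroup (k + 1) :=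
    Subgroup.mul_mem _ (Subgroup.inv_mem _ (hA b hbA)) (hA a haA)
  have hbad : b⁻¹ * a ∈ ringClassSubgroup K (p ^ d) jbar := by
    rw [← inf_ringClassSubgroup_eq_of_not_le hK jbar hp hd hle hnot]
    exact Subgroup.mem_inf.mpr ⟨hbaL, hba⟩
  obtain ⟨a', -, huniq'⟩ := htA a (hA a haA)
  rw [huniq' b ⟨hbA, hbad⟩, huniq' a ⟨haA, by rw [inv_mul_cancel]; exact Subgroup.one_mem _⟩]

/-! ## §2 The ITERATED vertical recurrence in a fixed layer -/

/-- **Iterated recurrence of the Heegner norms** (Perrin-Riou 1987 §3.3 / Howard 2004 §3.3 / CGLS Rem. 4.1.4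
"a straightforward calculation"): for `E = W/ℚ` at its level `N_E`, `K` Heegner, orientation `β`, a good prime
`p`, a system of points `x_j ∈ E(K̄)` over `φ(x(p^j))` with models `P_j ∈ E(K[p^j])`, each fixed by
`Gal(K̄/K[p^j])`, a subgroup `Λ ≥ Gal(K̄/K[p^{e+1}])`, ONE transversal `T ⊆ Λ` of `Gal(K̄/K[p^{e+1}])` in `Λ`
(`u := ∑_T t • x_{e+1}`, `v := ∑_T t • x_e`) and ANY integer sequences `A, B` with `A₀ = 1`, `A₁ = a_p`,
`B₀ = 0`, `B₁ = −1`, `X_{n+2} = a_p X_{n+1} − p X_n`: for every `n` and every transversal `R ⊆ Λ` of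
`Gal(K̄/K[p^{e+1+n}])` in `Λ`, `∑_R r • x_{e+1+n} = A_n • u + B_n • v`. Two-step induction: `n = 0` is
independence of the transversal, `n = 1` the one-step descent
(`sum_transversal_smul_eq_frobeniusTrace_smul_sub_of_le`), `n + 2` the two-term recurrence
(`sum_transversal_smul_eq_frobeniusTrace_smul_sub_prime_smul`) at auxiliary transversals.
[cite: PerrinRiou1987BSMF, §3.3 (relations de distribution)] [cite: Howard2004HeegnerKolyvagin, §3.3]
[cite: CastellaGrossiLeeSkinner2022, Rem. 4.1.4 ("the points α^{-k}P[p^k]_α are norm-compatible")] -/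
theorem sum_transversal_smul_eq_lucas_smul_add {W : WeierstrassCurve ℚ} [W.IsElliptic]
    [W.IsGloballyMinimal] [NeZero (W.conductorNorm ℤ)] (hK : IsImaginaryQuadratic K)
    (hH : SatisfiesHeegnerHypothesis (W.conductorNorm ℤ) K)
    (Dt : ModularForms.ModularParametrizationData W (W.conductorNorm ℤ)) {β : ℤ}
    (hβ : (4 * (W.conductorNorm ℤ : ℕ) : ℤ) ∣ β ^ 2 - NumberField.discr K)
    (jbar : AlgebraicClosure K →+* ℂ) {p : ℕ} (hp : p.Prime) (hpN : ¬ p ∣ W.conductorNorm ℤ)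
    {x : ℕ → WeierstrassCurve.geomPoints (W.baseChange K)}
    {P : ∀ j : ℕ,
      (W.baseChange (ringClassField K (jbar.comp (algebraMap K (AlgebraicClosure K))) (p ^ j))).toAffine.Point}
    (hx : ∀ j, complexPoint W jbar (x j) =
      ModularForms.heegnerPointComplexOfConductor Dt (NumberField.discr K) β (p ^ j))
    (hP : ∀ j, WeierstrassCurve.Affine.Point.map (W' := W)
      (ringClassField K (jbar.comp (algebraMap K (AlgebraicClosure K))) (p ^ j)).subtype.toRatAlgHom (P j) =
      ModularForms.heegnerPointComplexOfConductor Dt (NumberField.discr K) β (p ^ j))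
    (hfix : ∀ j, ∀ σ ∈ ringClassSubgroup K (p ^ j) jbar, σ • x j = x j)
    {e : ℕ} {Λ : Subgroup (Field.absoluteGaloisGroup K)} (hΛ : ringClassSubgroup K (p ^ (e + 1)) jbar ≤ Λ)
    {T : Finset (Field.absoluteGaloisGroup K)} (hT : ∀ t ∈ T, t ∈ Λ)
    (htT : ∀ τ ∈ Λ, ∃! t, t ∈ T ∧ t⁻¹ * τ ∈ ringClassSubgroup K (p ^ (e + 1)) jbar)
    (A B : ℕ → ℤ) (hA0 : A 0 = 1) (hA1 : A 1 = W.frobeniusTrace p)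
    (hA : ∀ n, A (n + 2) = W.frobeniusTrace p * A (n + 1) - p * A n)
    (hB0 : B 0 = 0) (hB1 : B 1 = -1) (hB : ∀ n, B (n + 2) = W.frobeniusTrace p * B (n + 1) - p * B n)
    (n : ℕ) {R : Finset (Field.absoluteGaloisGroup K)} (hR : ∀ r ∈ R, r ∈ Λ)
    (htR : ∀ τ ∈ Λ, ∃! r, r ∈ R ∧ r⁻¹ * τ ∈ ringClassSubgroup K (p ^ (e + 1 + n)) jbar) :
    ∑ r ∈ R, r • x (e + 1 + n) = A n • ∑ t ∈ T, t • x (e + 1) + B n • ∑ t ∈ T, t • x e := by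
  -- auxiliary transversals at every level `≥ e + 1` inside `Λ`
  have haux : ∀ m : ℕ, ∃ S : Finset (Field.absoluteGaloisGroup K), (∀ s ∈ S, s ∈ Λ) ∧
      ∀ τ ∈ Λ, ∃! s, s ∈ S ∧ s⁻¹ * τ ∈ ringClassSubgroup K (p ^ (e + 1 + m)) jbar := fun m ↦ by
    haveI := finiteIndex_ringClassSubgroup K (p ^ (e + 1 + m)) jbar
    exact exists_finset_transversal' _ _
  have hanti : ∀ m : ℕ, ringClassSubgroup K (p ^ (e + 1 + m)) jbar ≤ Λ := fun m ↦
    (ringClassSubgroup_anti hK jbar (pow_dvd_pow p (Nat.le_add_right _ _)) (pow_ne_zero _ hp.ne_zero)).trans hΛ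
  have hx₂ : ∀ j, complexPoint W jbar (x j) = WeierstrassCurve.Affine.Point.map (W' := W)
      (ringClassField K (jbar.comp (algebraMap K (AlgebraicClosure K))) (p ^ j)).subtype.toRatAlgHom (P j) :=
    fun j ↦ (hx j).trans (hP j).symm
  induction n using Nat.twoStepInduction generalizing R with
  | zero =>
    simp only [hA0, hB0, one_smul, zero_smul, add_zero]
    exact sum_smul_eq_of_transversal hR hT htR htT (hfix (e + 1))
  | one =>
    rw [hA1, hB1, neg_smul, one_smul, ← sub_eq_add_neg]
    exact sum_transversal_smul_eq_frobeniusTrace_smul_sub_of_le hK hH Dt hβ jbar hp hpN e (hx e)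
      (hx (e + 1)) (hx₂ (e + 2)) (hP (e + 2)) (hfix (e + 2)) hΛ hT htT hR htR
  | more n ih0 ih1 =>
    obtain ⟨A₀, hA₀, htA₀⟩ := haux n
    obtain ⟨A₁, hA₁, htA₁⟩ := haux (n + 1)
    have key := sum_transversal_smul_eq_frobeniusTrace_smul_sub_prime_smul hK hH Dt hβ jbar hp hpN
      (e := e + 1 + n) (by omega) (hx (e + 1 + n)) (hfix (e + 1 + n)) (hx (e + 1 + n + 1))
      (hx₂ (e + 1 + n + 2)) (hP (e + 1 + n + 2)) (hfix (e + 1 + n + 2)) (hanti n) hA₀ htA₀ hA₁ htA₁ hR htR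
    have h0 := ih0 hA₀ htA₀
    have h1 := ih1 hA₁ htA₁
    rw [show e + 1 + (n + 1) = e + 1 + n + 1 from by omega] at h1
    rw [show e + 1 + (n + 2) = e + 1 + n + 2 from by omega, key, h0, h1, hA n, hB n]
    simp only [sub_smul, mul_smul, smul_add]
    abel

/-- **The leading coefficients are `p`-adic units**: for integer `A` with `A₀ = 1`, `A₁ = a`,
`A_{n+2} = a A_{n+1} − p A_n` and `p ∤ a` (ordinary `p`: `a = a_p`), `p ∤ A_n` for every `n`
(`A_n ≡ a^n (mod p)`). [cite: PerrinRiou1987BSMF, §3.3] [cite: CastellaGrossiLeeSkinner2022, Rem. 4.1.4 (α the p-adic unit root of x² − a_p x + p)] -/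
theorem not_dvd_lucas_of_not_dvd {p : ℕ} {a : ℤ} (ha : ¬ (p : ℤ) ∣ a) (A : ℕ → ℤ) (hA0 : A 0 = 1)
    (hA1 : A 1 = a) (hA : ∀ n, A (n + 2) = a * A (n + 1) - p * A n) (hp : p.Prime) (n : ℕ) :
    ¬ (p : ℤ) ∣ A n := by
  have hpr : Prime (p : ℤ) := Int.prime_iff_natAbs_prime.mpr (by simpa using hp)
  induction n using Nat.twoStepInduction with
  | zero => rw [hA0]; exact fun h ↦ hp.one_lt.ne' (by simpa using Int.eq_one_of_dvd_one (Int.natCast_nonneg p) h)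
  | one => rwa [hA1]
  | more n _ ih1 =>
    rw [hA n]
    intro h
    have h' : (p : ℤ) ∣ a * A (n + 1) := by
      have := dvd_add h (dvd_mul_right (p : ℤ) (A n))
      rwa [sub_add_cancel] at this
    rcases hpr.dvd_or_dvd h' with h1 | h1
    · exact ha h1
    · exact ih1 h1

end Literature.NumberTheory.EllipticCurves

end
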